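import Literature.NumberTheory.LFunctions.DeBruijnHDiv
import Literature.NumberTheory.LFunctions.NewmanProofs
import Mathlib.Analysis.SpecialFunctions.ImproperIntegrals
import Mathlib.MeasureTheory.Integral.Prod
import Mathlib.MeasureTheory.Measure.Lebesgue.Integral
import Summits.RiemannHypothesis.RiemannHypothesis.Theses.UniversalFactor

/-!
# RiemannHypothesis / UniversalFactor — the Laplace smoothing as a convolution:
`F_a(z) = (a/2) ∫ℝ e^{−a|y|} H_0(z − y) dy`

Route `RiemannHypothesis/UniversalFactor`, helper for the target item stmt-RiemannHypothesis-2575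
(`LaplaceLoophole`) and for every no-go item of its kill path (the wide-kernel tail, the certified
numerics of the medium window and the Riemann–Siegel analysis of the narrow window all start from this
formula).  With `Φ = deBruijnPhi`, `H_0 = deBruijnH 0` and
`F_a = deBruijnHDiv (fun u ↦ 1 + u²/a²)` (`= ∫₀^∞ Φ(u)(1 + u²/a²)⁻¹ cos(zu) du`, the integral inlined in
the route's items), we prove for every `a > 0` and every COMPLEX `z`:

* `integral_Ioi_exp_neg_mul_cos`, `integral_laplaceKernel_mul_cos` — the Fourier–cosine transform of the
  Laplace density: `∫ℝ (a/2) e^{−a|y|} cos(uy) dy = 1/(1 + u²/a²)`;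
* `norm_deBruijnH_zero_le_of_im` — `H_0` is bounded on every horizontal line (from the tree's
  `norm_deBruijnH_le`), whence `integrable_laplaceKernel_mul_deBruijnH_sub/add`;
* `integral_deBruijnPhi_mul_cos_mul_cos` — `∫₀^∞ Φ(u) cos(zu) cos(yu) du = (H_0(z+y) + H_0(z−y))/2`;
* `deBruijnHDiv_laplace_eq_integral_symm` and **`deBruijnHDiv_laplace_eq_conv`** — Fubini:
  `F_a(z) = ∫ℝ (a/2)e^{−a|y|} (H_0(z+y) + H_0(z−y))/2 dy = ∫ℝ (a/2) e^{−a|y|} H_0(z − y) dy`.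

Only boundedness of `H_0` on horizontal lines is needed (no decay estimate for `Ξ`), because the
symmetric form comes for free from Fubini and the two halves are then separately integrable.

References: standard (Fourier pair `a²/(a²+u²) ↔ (a/2)e^{−a|x|}`); route file
`Summits/RiemannHypothesis/RiemannHypothesis/Theses/UniversalFactor.lean` (thesis, `F_a = E[H_0(· + X)]`,
`X ~ Laplace(a)`).
-/

noncomputable section

open MeasureTheory Set Filter
open scoped Topology

namespace Summit.RiemannHypothesis.RiemannHypothesis.Theorems

open Literature.NumberTheory.LFunctions

/-! ## The Laplace density and its cosine transform -/

/-- `∫₀^∞ e^{−ax} cos(ux) dx = a/(a² + u²)` for `a > 0` (real part of `∫₀^∞ e^{(−a+iu)x} dx = 1/(a − iu)`).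
[folklore] -/
theorem integral_Ioi_exp_neg_mul_cos {a : ℝ} (ha : 0 < a) (u : ℝ) :
    ∫ x in Ioi (0:ℝ), Real.exp (-(a * x)) * Real.cos (u * x) = a / (a ^ 2 + u ^ 2) := by
  set c : ℂ := -(a : ℂ) + (u : ℂ) * Complex.I with hc
  have hcre : c.re = -a := by simp [hc]
  have hcim : c.im = u := by simp [hc]
  have hre : c.re < 0 := by rw [hcre]; linarith
  have hint : IntegrableOn (fun x : ℝ => Complex.exp (c * x)) (Ioi 0) :=
    integrableOn_exp_mul_complex_Ioi hre 0
  have hval : ∫ x in Ioi (0:ℝ), Complex.exp (c * x) = -1 / c := by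
    rw [integral_exp_mul_complex_Ioi hre 0]; simp
  have h1 : ∀ x : ℝ, Real.exp (-(a * x)) * Real.cos (u * x) = RCLike.re (Complex.exp (c * x)) := by
    intro x
    rw [RCLike.re_to_complex, Complex.exp_re]
    have hr : (c * x).re = -(a * x) := by simp [hc]
    have hi : (c * x).im = u * x := by simp [hc]
    rw [hr, hi]
  simp_rw [h1]
  rw [integral_re hint, hval, RCLike.re_to_complex, neg_div, Complex.neg_re, Complex.div_re,
    Complex.one_re, Complex.one_im, Complex.normSq_apply, hcre, hcim]
  have hpos : 0 < a * a + u * u := by nlinarith [mul_self_nonneg u, mul_pos ha ha]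
  field_simp
  ring

/-- `cos(u|y|) = cos(uy)`. [folklore] -/
theorem cos_mul_abs (u y : ℝ) : Real.cos (u * |y|) = Real.cos (u * y) := by
  rcases abs_choice y with h | h
  · rw [h]
  · rw [h, mul_neg, Real.cos_neg]

/-- **Cosine transform of the Laplace density**: `∫ℝ (a/2) e^{−a|y|} cos(uy) dy = 1/(1 + u²/a²)`
(`= a²/(a² + u²)`), `a > 0`. [folklore] -/
theorem integral_laplaceKernel_mul_cos {a : ℝ} (ha : 0 < a) (u : ℝ) :
    ∫ y : ℝ, a / 2 * Real.exp (-(a * |y|)) * Real.cos (u * y) = a ^ 2 / (a ^ 2 + u ^ 2) := by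
  have h1 : (fun y : ℝ => a / 2 * Real.exp (-(a * |y|)) * Real.cos (u * y)) =
      fun y : ℝ => (fun x : ℝ => a / 2 * (Real.exp (-(a * x)) * Real.cos (u * x))) |y| := by
    funext y
    simp only [cos_mul_abs, mul_assoc]
  rw [h1, integral_comp_abs (f := fun x : ℝ => a / 2 * (Real.exp (-(a * x)) * Real.cos (u * x))),
    integral_const_mul, integral_Ioi_exp_neg_mul_cos ha u]
  ring

/-- `1/(1 + u²/a²) = a²/(a² + u²)` for `a ≠ 0`. [folklore] -/
theorem one_div_one_add_sq_div_sq {a : ℝ} (ha : a ≠ 0) (u : ℝ) :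
    1 / (1 + u ^ 2 / a ^ 2) = a ^ 2 / (a ^ 2 + u ^ 2) := by
  have hpos : 0 < a ^ 2 + u ^ 2 := by positivity
  rw [div_eq_div_iff (by positivity) hpos.ne']
  field_simp

/-- The Laplace density `(a/2) e^{−a|y|}` is integrable over `ℝ` (`a > 0`). [folklore] -/
theorem integrable_exp_neg_mul_abs {a : ℝ} (ha : 0 < a) :
    Integrable fun y : ℝ => Real.exp (-(a * |y|)) := by
  have hIoi : IntegrableOn (fun y : ℝ => Real.exp (-(a * |y|))) (Ioi 0) :=
    (exp_neg_integrableOn_Ioi 0 ha).congr_fun (fun y hy => by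
      simp only [abs_of_pos (show (0 : ℝ) < y from hy), neg_mul]) measurableSet_Ioi
  have hIic : IntegrableOn (fun y : ℝ => Real.exp (-(a * |y|))) (Iic 0) := by
    rw [← Measure.map_neg_eq_self (volume : Measure ℝ)]
    let m : MeasurableEmbedding fun x : ℝ => -x := (Homeomorph.neg ℝ).measurableEmbedding
    rw [m.integrableOn_map_iff]
    simp_rw [Function.comp_def, abs_neg, neg_preimage, neg_Iic, neg_zero]
    exact Iff.mpr integrableOn_Ici_iff_integrableOn_Ioi hIoi
  have := hIic.union hIoi
  rwa [Iic_union_Ioi, integrableOn_univ] at this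

/-- The Laplace density `(a/2) e^{−a|y|}` is integrable over `ℝ` (`a > 0`). [folklore] -/
theorem integrable_laplaceKernel {a : ℝ} (ha : 0 < a) :
    Integrable fun y : ℝ => a / 2 * Real.exp (-(a * |y|)) :=
  (integrable_exp_neg_mul_abs ha).const_mul (a / 2)

/-- The Laplace density is continuous. [folklore] -/
theorem continuous_laplaceKernel (a : ℝ) :
    Continuous fun y : ℝ => a / 2 * Real.exp (-(a * |y|)) := by
  fun_prop

/-- The Laplace density is even. [folklore] -/
theorem laplaceKernel_neg (a y : ℝ) :
    a / 2 * Real.exp (-(a * |(-y)|)) = a / 2 * Real.exp (-(a * |y|)) := by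
  rw [abs_neg]

/-! ## `H_0` on horizontal lines -/

/-- `H_0` is bounded on every horizontal strip `|Im w| ≤ Y` (from `norm_deBruijnH_le`:
`‖H_0(w)‖ ≤ K exp(|Im w| √|Im w|)`). [folklore] -/
theorem norm_deBruijnH_zero_le_of_im (Y : ℝ) :
    ∃ M : ℝ, 0 ≤ M ∧ ∀ w : ℂ, |w.im| ≤ Y → ‖deBruijnH 0 w‖ ≤ M := by
  obtain ⟨K, hK, hb⟩ := Newman.norm_deBruijnH_le 0
  refine ⟨K * Real.exp (|Y| * Real.sqrt |Y|), by positivity, fun w hw => (hb w).trans ?_⟩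
  have hY : |w.im| ≤ |Y| := hw.trans (le_abs_self Y)
  gcongr

/-- `H_0` is continuous. [folklore] -/
theorem continuous_deBruijnH_zero : Continuous (deBruijnH 0) :=
  (differentiable_deBruijnH_holds 0).continuous

/-- `y ↦ (a/2)e^{−a|y|} H_0(z − y)` is integrable over `ℝ` for `a > 0` (bounded times integrable).
[folklore] -/
theorem integrable_laplaceKernel_mul_deBruijnH_sub {a : ℝ} (ha : 0 < a) (z : ℂ) :
    Integrable fun y : ℝ => ((a / 2 * Real.exp (-(a * |y|)) : ℝ) : ℂ) * deBruijnH 0 (z - y) := by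
  obtain ⟨M, hM0, hM⟩ := norm_deBruijnH_zero_le_of_im |z.im|
  have hmeas : AEStronglyMeasurable
      (fun y : ℝ => ((a / 2 * Real.exp (-(a * |y|)) : ℝ) : ℂ) * deBruijnH 0 (z - y)) volume := by
    refine (Continuous.mul ?_ ?_).aestronglyMeasurable
    · exact Complex.continuous_ofReal.comp (continuous_laplaceKernel a)
    · exact continuous_deBruijnH_zero.comp (continuous_const.sub Complex.continuous_ofReal)
  refine ((integrable_laplaceKernel ha).norm.mul_const M).mono' hmeas (Eventually.of_forall fun y => ?_)
  rw [norm_mul, Complex.norm_real]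
  gcongr
  exact hM _ (by simp)

/-- `y ↦ (a/2)e^{−a|y|} H_0(z + y)` is integrable over `ℝ` for `a > 0`. [folklore] -/
theorem integrable_laplaceKernel_mul_deBruijnH_add {a : ℝ} (ha : 0 < a) (z : ℂ) :
    Integrable fun y : ℝ => ((a / 2 * Real.exp (-(a * |y|)) : ℝ) : ℂ) * deBruijnH 0 (z + y) := by
  have h := (integrable_laplaceKernel_mul_deBruijnH_sub ha z).comp_neg
  refine h.congr (Eventually.of_forall fun y => ?_)
  simp only [abs_neg, Complex.ofReal_neg, sub_neg_eq_add]

/-! ## The `u`-integral: `∫₀^∞ Φ(u) cos(zu) cos(yu) du` -/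

/-- `H_0(w) = ∫₀^∞ Φ(u) cos(wu) du` (the weight `e^{0·u²}` removed). [folklore] -/
theorem deBruijnH_zero_eq_integral_cos (w : ℂ) :
    deBruijnH 0 w = ∫ u in Ioi (0:ℝ), ((deBruijnPhi u : ℝ) : ℂ) * Complex.cos (w * u) := by
  rw [deBruijnH]
  refine setIntegral_congr_fun measurableSet_Ioi fun u _ => ?_
  simp

/-- The integrand `Φ(u) cos(wu)` is integrable on `(0, ∞)` for every complex `w`. [folklore] -/
theorem integrableOn_deBruijnPhi_mul_cos (w : ℂ) :
    IntegrableOn (fun u : ℝ => ((deBruijnPhi u : ℝ) : ℂ) * Complex.cos (w * u)) (Ioi 0) := by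
  refine (integrableOn_deBruijnHIntegrand 0 w).congr_fun (fun u _ => ?_) measurableSet_Ioi
  simp [deBruijnHIntegrand]

/-- **Product-to-sum under the integral**: `∫₀^∞ Φ(u) cos(zu) cos(yu) du = (H_0(z+y) + H_0(z−y))/2`.
[folklore] -/
theorem integral_deBruijnPhi_mul_cos_mul_cos (z y : ℂ) :
    ∫ u in Ioi (0:ℝ), ((deBruijnPhi u : ℝ) : ℂ) * (Complex.cos (z * u) * Complex.cos (y * u)) =
      (deBruijnH 0 (z + y) + deBruijnH 0 (z - y)) / 2 := by
  have hcos : ∀ u : ℝ, Complex.cos (z * u) * Complex.cos (y * u) =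
      (Complex.cos ((z + y) * u) + Complex.cos ((z - y) * u)) / 2 := by
    intro u
    rw [add_mul, sub_mul, Complex.cos_add, Complex.cos_sub]
    ring
  simp_rw [hcos]
  have h2 : ∀ u : ℝ, ((deBruijnPhi u : ℝ) : ℂ) *
      ((Complex.cos ((z + y) * u) + Complex.cos ((z - y) * u)) / 2) =
      (1 / 2 : ℂ) * (((deBruijnPhi u : ℝ) : ℂ) * Complex.cos ((z + y) * u) +
        ((deBruijnPhi u : ℝ) : ℂ) * Complex.cos ((z - y) * u)) := by
    intro u; ring
  simp_rw [h2]
  rw [integral_const_mul, integral_add (integrableOn_deBruijnPhi_mul_cos (z + y))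
    (integrableOn_deBruijnPhi_mul_cos (z - y)), ← deBruijnH_zero_eq_integral_cos,
    ← deBruijnH_zero_eq_integral_cos]
  ring

/-! ## Fubini -/

/-- The two-variable integrand `G(u, y) = Φ(u) cos(zu) · (a/2)e^{−a|y|} cos(uy)` on `(0,∞) × ℝ`.
Its `y`-integral is `Φ(u) cos(zu)/(1 + u²/a²)`, its `u`-integral is
`(a/2)e^{−a|y|} (H_0(z+y) + H_0(z−y))/2`, and it is absolutely integrable. [folklore] -/
theorem integrable_laplace_fubini_integrand {a : ℝ} (ha : 0 < a) (z : ℂ) :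
    Integrable (Function.uncurry fun (u y : ℝ) => ((deBruijnPhi u : ℝ) : ℂ) * Complex.cos (z * u) *
        ((a / 2 * Real.exp (-(a * |y|)) * Real.cos (u * y) : ℝ) : ℂ))
      ((volume.restrict (Ioi (0:ℝ))).prod volume) := by
  rw [Function.uncurry_def]
  -- majorant `deBruijnHBound 0 |Im z| u · (a/2) e^{−a|y|}`
  have hB : Integrable (deBruijnHBound 0 |z.im|) (volume.restrict (Ioi (0:ℝ))) :=
    integrableOn_deBruijnHBound 0 |z.im|
  have hk : Integrable (fun y : ℝ => a / 2 * Real.exp (-(a * |y|))) volume :=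
    integrable_laplaceKernel ha
  have hprod := hB.mul_prod hk
  refine hprod.mono' ?_ ?_
  · -- measurability: `Φ ∘ fst` is a.e. strongly measurable, the rest is continuous
    have h1 : AEStronglyMeasurable (fun p : ℝ × ℝ => ((deBruijnPhi p.1 : ℝ) : ℂ))
        ((volume.restrict (Ioi (0:ℝ))).prod volume) := by
      have h0 : AEStronglyMeasurable (fun u : ℝ => ((deBruijnPhi u : ℝ) : ℂ))
          (volume.restrict (Ioi (0:ℝ))) :=
        Complex.continuous_ofReal.comp_aestronglyMeasurable
          ((continuousOn_deBruijnPhi_Ici.mono Ioi_subset_Ici_self).aestronglyMeasurable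
            measurableSet_Ioi)
      exact h0.comp_fst
    have h2 : Continuous fun p : ℝ × ℝ => Complex.cos (z * p.1) *
        ((a / 2 * Real.exp (-(a * |p.2|)) * Real.cos (p.1 * p.2) : ℝ) : ℂ) := by
      fun_prop
    refine (h1.mul h2.aestronglyMeasurable).congr (Eventually.of_forall fun p => ?_)
    simp only [Pi.mul_apply, mul_assoc]
  · have hmeas : MeasurableSet (Ioi (0:ℝ) ×ˢ (univ : Set ℝ)) := measurableSet_Ioi.prod MeasurableSet.univ
    have hre : (volume.restrict (Ioi (0:ℝ))).prod (volume : Measure ℝ) =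
        ((volume : Measure ℝ).prod (volume : Measure ℝ)).restrict (Ioi (0:ℝ) ×ˢ univ) := by
      rw [← Measure.prod_restrict, Measure.restrict_univ]
    rw [hre]
    refine ae_restrict_of_forall_mem hmeas fun p hp => ?_
    have hu : 0 < p.1 := hp.1
    rw [norm_mul, Complex.norm_real, Real.norm_eq_abs]
    have hI : ‖((deBruijnPhi p.1 : ℝ) : ℂ) * Complex.cos (z * p.1)‖ ≤ deBruijnHBound 0 |z.im| p.1 := by
      have := norm_deBruijnHIntegrand_le (t := 0) (T := 0) (z := z) le_rfl le_rfl hu.le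
      simpa [deBruijnHIntegrand] using this
    have hK : |a / 2 * Real.exp (-(a * |p.2|)) * Real.cos (p.1 * p.2)| ≤
        a / 2 * Real.exp (-(a * |p.2|)) := by
      rw [abs_mul, abs_of_pos (by positivity : 0 < a / 2 * Real.exp (-(a * |p.2|)))]
      exact mul_le_of_le_one_right (by positivity) (Real.abs_cos_le_one _)
    exact mul_le_mul hI hK (abs_nonneg _) (deBruijnHBound_nonneg _ _ _)

/-- **The Laplace smoothing, symmetric form** (Fubini): for `a > 0` and every complex `z`,
`F_a(z) = ∫ℝ (a/2) e^{−a|y|} · (H_0(z + y) + H_0(z − y))/2 dy`. [folklore] -/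
theorem deBruijnHDiv_laplace_eq_integral_symm {a : ℝ} (ha : 0 < a) (z : ℂ) :
    deBruijnHDiv (fun u : ℝ => 1 + u ^ 2 / a ^ 2) z =
      ∫ y : ℝ, ((a / 2 * Real.exp (-(a * |y|)) : ℝ) : ℂ) *
        ((deBruijnH 0 (z + y) + deBruijnH 0 (z - y)) / 2) := by
  set G : ℝ → ℝ → ℂ := fun u y => ((deBruijnPhi u : ℝ) : ℂ) * Complex.cos (z * u) *
    ((a / 2 * Real.exp (-(a * |y|)) * Real.cos (u * y) : ℝ) : ℂ) with hG
  -- the `y`-integral of `G u`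
  have hy : ∀ u : ℝ, ∫ y : ℝ, G u y =
      ((deBruijnPhi u / (1 + u ^ 2 / a ^ 2) : ℝ) : ℂ) * Complex.cos (z * u) := by
    intro u
    simp only [hG]
    rw [integral_const_mul, integral_complex_ofReal, integral_laplaceKernel_mul_cos ha u,
      ← one_div_one_add_sq_div_sq ha.ne' u]
    push_cast
    ring
  -- the `u`-integral of `G · y`
  have hu : ∀ y : ℝ, ∫ u in Ioi (0:ℝ), G u y =
      ((a / 2 * Real.exp (-(a * |y|)) : ℝ) : ℂ) * ((deBruijnH 0 (z + y) + deBruijnH 0 (z - y)) / 2) := by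
    intro y
    have h1 : ∀ u : ℝ, G u y = ((a / 2 * Real.exp (-(a * |y|)) : ℝ) : ℂ) *
        (((deBruijnPhi u : ℝ) : ℂ) * (Complex.cos (z * u) * Complex.cos ((y : ℂ) * u))) := by
      intro u
      simp only [hG]
      push_cast
      rw [mul_comm (u : ℂ) (y : ℂ)]
      ring
    simp_rw [h1]
    rw [integral_const_mul, integral_deBruijnPhi_mul_cos_mul_cos]
  -- Fubini
  have hF : deBruijnHDiv (fun u : ℝ => 1 + u ^ 2 / a ^ 2) z = ∫ u in Ioi (0:ℝ), ∫ y : ℝ, G u y := by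
    rw [deBruijnHDiv]
    exact setIntegral_congr_fun measurableSet_Ioi fun u _ => (hy u).symm
  rw [hF, integral_integral_swap (integrable_laplace_fubini_integrand ha z)]
  exact integral_congr_ae (Eventually.of_forall hu)

/-- **The Laplace smoothing is the convolution `H_0 ∗ (a/2)e^{−a|·|}`**: for `a > 0` and every
complex `z`, `F_a(z) = ∫₀^∞ Φ(u)(1 + u²/a²)⁻¹ cos(zu) du = ∫ℝ (a/2) e^{−a|y|} H_0(z − y) dy`
(`= E[H_0(z + X)]`, `X ~ Laplace(a)`). [folklore] -/
theorem deBruijnHDiv_laplace_eq_conv {a : ℝ} (ha : 0 < a) (z : ℂ) :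
    deBruijnHDiv (fun u : ℝ => 1 + u ^ 2 / a ^ 2) z =
      ∫ y : ℝ, ((a / 2 * Real.exp (-(a * |y|)) : ℝ) : ℂ) * deBruijnH 0 (z - y) := by
  rw [deBruijnHDiv_laplace_eq_integral_symm ha z]
  have hsplit : ∀ y : ℝ, ((a / 2 * Real.exp (-(a * |y|)) : ℝ) : ℂ) *
      ((deBruijnH 0 (z + y) + deBruijnH 0 (z - y)) / 2) =
      (1 / 2 : ℂ) * (((a / 2 * Real.exp (-(a * |y|)) : ℝ) : ℂ) * deBruijnH 0 (z + y)) +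
      (1 / 2 : ℂ) * (((a / 2 * Real.exp (-(a * |y|)) : ℝ) : ℂ) * deBruijnH 0 (z - y)) := by
    intro y; ring
  simp_rw [hsplit]
  rw [integral_add ((integrable_laplaceKernel_mul_deBruijnH_add ha z).const_mul _)
    ((integrable_laplaceKernel_mul_deBruijnH_sub ha z).const_mul _), integral_const_mul,
    integral_const_mul]
  have hflip : ∫ y : ℝ, ((a / 2 * Real.exp (-(a * |y|)) : ℝ) : ℂ) * deBruijnH 0 (z + y) =
      ∫ y : ℝ, ((a / 2 * Real.exp (-(a * |y|)) : ℝ) : ℂ) * deBruijnH 0 (z - y) := by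
    rw [← integral_neg_eq_self
      (fun y : ℝ => ((a / 2 * Real.exp (-(a * |y|)) : ℝ) : ℂ) * deBruijnH 0 (z + y)) volume]
    refine integral_congr_ae (Eventually.of_forall fun y => ?_)
    simp only [abs_neg, Complex.ofReal_neg, ← sub_eq_add_neg]
  rw [hflip]
  ring

/-- The convolution formula in the route's inlined notation: for `a > 0` and complex `z`,
`∫₀^∞ (Φ(u)/(1 + u²/a²)) cos(zu) du = ∫ℝ (a/2) e^{−a|y|} H_0(z − y) dy`. [folklore] -/
theorem laplace_transform_eq_conv {a : ℝ} (ha : 0 < a) (z : ℂ) :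
    (∫ u in Set.Ioi (0:ℝ), ((deBruijnPhi u / (1 + u ^ 2 / a ^ 2) : ℝ) : ℂ) * Complex.cos (z * u)) =
      ∫ y : ℝ, ((a / 2 * Real.exp (-(a * |y|)) : ℝ) : ℂ) * deBruijnH 0 (z - y) :=
  deBruijnHDiv_laplace_eq_conv ha z

/-- On the real axis: `F_a(x) = ∫ℝ (a/2) e^{−a|y|} H_0(x − y) dy` for real `x`, the form used by the
wide-kernel tail and by the numerics of the medium window. [folklore] -/
theorem deBruijnHDiv_laplace_ofReal_eq_conv {a : ℝ} (ha : 0 < a) (x : ℝ) :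
    deBruijnHDiv (fun u : ℝ => 1 + u ^ 2 / a ^ 2) x =
      ∫ y : ℝ, ((a / 2 * Real.exp (-(a * |y|)) : ℝ) : ℂ) * deBruijnH 0 ((x - y : ℝ) : ℂ) := by
  rw [deBruijnHDiv_laplace_eq_conv ha x]
  refine integral_congr_ae (Eventually.of_forall fun y => ?_)
  push_cast
  ring_nf

end Summit.RiemannHypothesis.RiemannHypothesis.Theorems
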